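import Literature.NumberTheory.CubicFields.DeloneFaddeevEquivariance
import HarnessLib

/-!
# The Davenport–Heilbronn maximality sets `U_p` and the index-`p` overrings of `R(f)`

Topic `Literature/NumberTheory/CubicFields`, continuing the Levi–Delone–Faddeev files
(`RingOfForm f = R(f)`, `GL2ZEquiv`, `R(γ · f) ≅ R(f)`).

Bhargava–Taniguchi–Thorne 2023, §2.1–2.2: a cubic ring `R` is *maximal* if "there is no other
cubic ring `R'` properly containing `R`", and

> **Proposition 2.2 ([DH]).** Under the Levi–Delone–Faddeev correspondence, a cubic ring `R` is
> maximal if and only if any corresponding cubic form `f` belongs to the set `U_p ⊂ V(ℤ)` for all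
> `p`, defined by the following conditions: the cubic form `f` is not a multiple of `p`; and there
> is no `GL₂(ℤ)`-transformation of `f(u, v) = a u³ + b u²v + c uv² + d v³` such that `a` is a
> multiple of `p²` and `b` is a multiple of `p`.

This file formalizes the two notions and proves the direction "maximal ⇒ `f ∈ U_p` for all `p`"
through the two explicit index-`p` overrings of Davenport–Heilbronn:

* `BinaryCubic.MemU p f` — `f ∈ U_p` exactly as printed;
* `RingOfForm.IsMaximal f` — `R(f)` is a maximal cubic ring: every injective ring homomorphism
  `R(f) → R(g)` into a cubic ring is surjective (every cubic ring is some `R(g)`,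
  `DeloneFaddeevSurjective`; an injection of cubic rings is an inclusion of full rank);
* `RingOfForm.ofMultiple` — for `f = p · g`: the embedding `R(p · g) ↪ R(g)`, `ω ↦ pω`, `θ ↦ pθ`
  (`R(pg) = ℤ + p R(g)`), injective and not surjective;
* `RingOfForm.ofSqDvd` — for `f = (p²a', pb', c, d)`: the embedding `R(f) ↪ R((a', b', c, pd))`,
  `ω ↦ pω`, `θ ↦ θ` (the index-`p` overring `ℤ + ℤ(ω/p) + ℤθ`), injective and not surjective;
* `RingOfForm.not_isMaximal_of_not_memU` — **if `f ∉ U_p` for some prime `p` (indeed any `p > 1`)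
  then `R(f)` is not maximal**, and `RingOfForm.memU_of_isMaximal` — **a maximal `R(f)` has
  `f ∈ U_p` for all `p`** (Prop. 2.2, "only if");
* `RingOfForm.IsMaximal.of_gl2zEquiv` — maximality is a property of the `GL₂(ℤ)`-orbit.

NOT here: the converse "`f ∈ U_p` for all `p` ⇒ `R(f)` maximal" (the classification of index-`p`
overrings), maximality as integral closedness, and the local densities of `U_p` (BTT (9)).

## References

* M. Bhargava, T. Taniguchi, F. Thorne, *Improved error estimates for the Davenport–Heilbronn
  theorems*, Math. Ann. 389 (2024) = arXiv:2107.12819, §2.1 and Prop. 2.2 [BhargavaTaniguchiThorne2023].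
* H. Davenport, H. Heilbronn, *On the density of discriminants of cubic fields. II*, Proc. Roy.
  Soc. London A 322 (1971) 405–420 [DavenportHeilbronn1971].
* M. Bhargava, A. Shankar, J. Tsimerman, *On the Davenport–Heilbronn theorems and second order
  terms*, Invent. Math. 193 (2013), §3 [BhargavaShankarTsimerman2012].
-/

namespace Literature.NumberTheory.CubicFields

open BinaryCubic

namespace BinaryCubic

/-- The twisted action is linear: `γ · (μ f) = μ (γ · f)`. [folklore] -/
theorem twist_smul {R : Type*} [CommRing R] (γ : Matrix (Fin 2) (Fin 2) R) (μ : R) (f : BinaryCubic R) :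
    twist γ (μ • f) = μ • twist γ f := by
  rw [twist, twist, smul_subst, ← mul_smul, ← mul_smul, mul_comm]

/-- `f` is a multiple of `p`: all four coefficients are divisible by `p`. [folklore] -/
def IsMultiple (p : ℤ) (f : BinaryCubic ℤ) : Prop :=
  p ∣ f.a ∧ p ∣ f.b ∧ p ∣ f.c ∧ p ∣ f.d

/-- `f` is a multiple of `p` iff `f = p • g` for some integral form `g`. [folklore] -/
theorem isMultiple_iff_exists_smul {p : ℤ} {f : BinaryCubic ℤ} : f.IsMultiple p ↔ ∃ g : BinaryCubic ℤ, f = p • g := by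
  constructor
  · rintro ⟨⟨a', ha⟩, ⟨b', hb⟩, ⟨c', hc⟩, ⟨d', hd⟩⟩
    exact ⟨⟨a', b', c', d'⟩, BinaryCubic.ext ha hb hc hd⟩
  · rintro ⟨g, rfl⟩
    exact ⟨⟨g.a, rfl⟩, ⟨g.b, rfl⟩, ⟨g.c, rfl⟩, ⟨g.d, rfl⟩⟩

/-- **The Davenport–Heilbronn set `U_p`** (BTT 2023, Prop. 2.2): `f ∈ U_p` iff `f` is not a
multiple of `p` and no `GL₂(ℤ)`-translate of `f` has `p² ∣ a` and `p ∣ b`. [cite: BhargavaTaniguchiThorne2023, Proposition 2.2 (the set U_p)] -/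
def MemU (p : ℕ) (f : BinaryCubic ℤ) : Prop :=
  ¬ f.IsMultiple p ∧ ¬ ∃ g : BinaryCubic ℤ, GL2ZEquiv f g ∧ (p : ℤ) ^ 2 ∣ g.a ∧ (p : ℤ) ∣ g.b

/-- `U_p` is a union of `GL₂(ℤ)`-orbits. [folklore] -/
theorem MemU.of_gl2zEquiv {p : ℕ} {f g : BinaryCubic ℤ} (h : GL2ZEquiv f g) (hf : f.MemU p) : g.MemU p := by
  refine ⟨fun hm => ?_, fun ⟨k, hk, hka, hkb⟩ => hf.2 ⟨k, h.trans hk, hka, hkb⟩⟩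
  -- a multiple of `p` stays a multiple of `p` under `GL₂(ℤ)` (the action is linear in `f`)
  obtain ⟨γ, -, rfl⟩ := h.symm
  obtain ⟨g', rfl⟩ := isMultiple_iff_exists_smul.mp hm
  exact hf.1 (isMultiple_iff_exists_smul.mpr ⟨twist γ g', twist_smul γ (p : ℤ) g'⟩)

end BinaryCubic

namespace RingOfForm

variable {f g : BinaryCubic ℤ}

/-- **Maximal cubic ring** (BTT 2023, §2.1: "there is no other cubic ring `R'` properly containing
`R`"), for `R = R(f)`: every injective ring homomorphism from `R(f)` to a cubic ring `R(g)` is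
surjective. (Every cubic ring is some `R(g)` by `DeloneFaddeevSurjective`, and an injection of
rings free of rank `3` is an inclusion of finite index, i.e. exhibits `R(g)` as a cubic ring
containing `R(f)`.) [cite: BhargavaTaniguchiThorne2023, §2.1 (maximal cubic ring)] -/
def IsMaximal (f : BinaryCubic ℤ) : Prop :=
  ∀ g : BinaryCubic ℤ, ∀ φ : RingOfForm f →+* RingOfForm g, Function.Injective φ → Function.Surjective φ

/-- Maximality is invariant under ring isomorphism, hence a property of the `GL₂(ℤ)`-orbit. [folklore] -/
theorem IsMaximal.of_ringEquiv (e : RingOfForm f ≃+* RingOfForm g) (hf : IsMaximal f) : IsMaximal g := by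
  intro k φ hφ
  have h := hf k (φ.comp e.toRingHom) (hφ.comp e.injective)
  intro y
  obtain ⟨x, hx⟩ := h y
  exact ⟨e x, hx⟩

/-- Maximality is a property of the `GL₂(ℤ)`-orbit. [folklore] -/
theorem IsMaximal.of_gl2zEquiv (h : GL2ZEquiv f g) (hf : IsMaximal f) : IsMaximal g := by
  obtain ⟨e⟩ := nonempty_ringEquiv_of_gl2zEquiv h
  exact hf.of_ringEquiv e.symm

/-! ### The overring of a multiple of `p`: `R(p g) = ℤ + p R(g) ⊂ R(g)` -/

/-- **`R(p · g) ↪ R(g)`**, `x + yω + zθ ↦ x + p y ω + p z θ`: the cubic ring of a multiple of `p`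
is the subring `ℤ + p R(g)` of index `p²` (BTT §2.2, the content; DH). [cite: BhargavaTaniguchiThorne2023, §2.2 (content: R = ℤ + nR')] -/
def ofMultiple (p : ℤ) (g : BinaryCubic ℤ) : RingOfForm (p • g) →+* RingOfForm g where
  toFun P := ⟨P.x, p * P.y, p * P.z⟩
  map_one' := by ext <;> simp
  map_mul' P Q := by ext <;> simp <;> ring
  map_zero' := by ext <;> simp
  map_add' P Q := by ext <;> simp [mul_add]

/-- `ofMultiple` on coordinates. [folklore] -/
@[simp] theorem ofMultiple_apply (p : ℤ) (g : BinaryCubic ℤ) (P : RingOfForm (p • g)) :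
    ofMultiple p g P = ⟨P.x, p * P.y, p * P.z⟩ := rfl

/-- `ofMultiple` is injective for `p ≠ 0`. [folklore] -/
theorem ofMultiple_injective {p : ℤ} (hp : p ≠ 0) (g : BinaryCubic ℤ) : Function.Injective (ofMultiple p g) := by
  intro P Q h
  have hx := congrArg RingOfForm.x h
  have hy := congrArg RingOfForm.y h
  have hz := congrArg RingOfForm.z h
  simp only [ofMultiple_apply] at hx hy hz
  ext
  · exact hx
  · exact mul_left_cancel₀ hp hy
  · exact mul_left_cancel₀ hp hz

/-- `ofMultiple` is not surjective for `|p| > 1` (`ω` is not in the image). [folklore] -/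
theorem ofMultiple_not_surjective {p : ℤ} (hp : ¬ IsUnit p) (g : BinaryCubic ℤ) :
    ¬ Function.Surjective (ofMultiple p g) := by
  intro h
  obtain ⟨P, hP⟩ := h (omega g)
  have hy := congrArg RingOfForm.y hP
  simp only [ofMultiple_apply, omega_y] at hy
  exact hp (IsUnit.of_mul_eq_one P.y hy)

/-! ### The overring of a form with `p² ∣ a`, `p ∣ b`: `ℤ + ℤ(ω/p) + ℤθ` -/

/-- **`R((p²a', pb', c, d)) ↪ R((a', b', c, pd))`**, `x + yω + zθ ↦ x + p y ω + z θ`: when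
`p² ∣ a` and `p ∣ b`, `ℤ + ℤ(ω/p) + ℤθ` is a cubic ring containing `R(f)` with index `p` — the
Davenport–Heilbronn obstruction to maximality (BTT Prop. 2.2). [cite: DavenportHeilbronn1971, §2 (the index-p overring when p² | a, p | b)] -/
def ofSqDvd (p a' b' c d : ℤ) :
    RingOfForm (⟨p ^ 2 * a', p * b', c, d⟩ : BinaryCubic ℤ) →+* RingOfForm (⟨a', b', c, p * d⟩ : BinaryCubic ℤ) where
  toFun P := ⟨P.x, p * P.y, P.z⟩
  map_one' := by ext <;> simp
  map_mul' P Q := by ext <;> simp <;> ring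
  map_zero' := by ext <;> simp
  map_add' P Q := by ext <;> simp [mul_add]

/-- `ofSqDvd` on coordinates. [folklore] -/
@[simp] theorem ofSqDvd_apply (p a' b' c d : ℤ) (P : RingOfForm (⟨p ^ 2 * a', p * b', c, d⟩ : BinaryCubic ℤ)) :
    ofSqDvd p a' b' c d P = ⟨P.x, p * P.y, P.z⟩ := rfl

/-- `ofSqDvd` is injective for `p ≠ 0`. [folklore] -/
theorem ofSqDvd_injective {p : ℤ} (hp : p ≠ 0) (a' b' c d : ℤ) : Function.Injective (ofSqDvd p a' b' c d) := by
  intro P Q h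
  have hx := congrArg RingOfForm.x h
  have hy := congrArg RingOfForm.y h
  have hz := congrArg RingOfForm.z h
  simp only [ofSqDvd_apply] at hx hy hz
  ext
  · exact hx
  · exact mul_left_cancel₀ hp hy
  · exact hz

/-- `ofSqDvd` is not surjective for `|p| > 1` (`ω` is not in the image). [folklore] -/
theorem ofSqDvd_not_surjective {p : ℤ} (hp : ¬ IsUnit p) (a' b' c d : ℤ) :
    ¬ Function.Surjective (ofSqDvd p a' b' c d) := by
  intro h
  obtain ⟨P, hP⟩ := h (omega _)
  have hy := congrArg RingOfForm.y hP
  simp only [ofSqDvd_apply, omega_y] at hy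
  exact hp (IsUnit.of_mul_eq_one P.y hy)

/-! ### Prop. 2.2, the direction "maximal ⇒ `f ∈ U_p`" -/

/-- A natural number `p > 1` is not a unit of `ℤ`. [folklore] -/
theorem not_isUnit_natCast {p : ℕ} (hp : 1 < p) : ¬ IsUnit (p : ℤ) := by
  rw [Int.isUnit_iff]
  omega

/-- **If `f ∉ U_p` (for some `p > 1`) then `R(f)` is not maximal** (Davenport–Heilbronn; BTT 2023,
Prop. 2.2, "only if"): if `p ∣ f` then `R(f) = ℤ + pR(f/p) ⊊ R(f/p)`; if a `GL₂(ℤ)`-translate `g`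
of `f` has `p² ∣ a`, `p ∣ b`, then `R(f) ≅ R(g) ⊊ ℤ + ℤ(ω/p) + ℤθ`. [cite: BhargavaTaniguchiThorne2023, Proposition 2.2 (maximal ⇒ f ∈ U_p)] -/
theorem not_isMaximal_of_not_memU {p : ℕ} (hp : 1 < p) (h : ¬ f.MemU p) : ¬ IsMaximal f := by
  have hp0 : (p : ℤ) ≠ 0 := by exact_mod_cast (show p ≠ 0 by omega)
  have hpu : ¬ IsUnit (p : ℤ) := not_isUnit_natCast hp
  intro hmax
  simp only [BinaryCubic.MemU, not_and_or, not_not] at h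
  rcases h with hm | ⟨g, hfg, ⟨a', ha⟩, ⟨b', hb⟩⟩
  · -- `f = p • g`
    obtain ⟨g, rfl⟩ := isMultiple_iff_exists_smul.mp hm
    exact ofMultiple_not_surjective hpu g (hmax _ (ofMultiple (p : ℤ) g) (ofMultiple_injective hp0 g))
  · -- `f ~ g` with `g = (p² a', p b', c, d)`
    have hg : g = ⟨(p : ℤ) ^ 2 * a', (p : ℤ) * b', g.c, g.d⟩ := BinaryCubic.ext ha hb rfl rfl
    have hmax' : IsMaximal g := hmax.of_gl2zEquiv hfg
    rw [hg] at hmax'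
    exact ofSqDvd_not_surjective hpu a' b' g.c g.d
      (hmax' _ (ofSqDvd (p : ℤ) a' b' g.c g.d) (ofSqDvd_injective hp0 a' b' g.c g.d))

/-- **A maximal cubic ring `R(f)` has `f ∈ U_p` for every `p > 1`** (in particular every prime;
BTT 2023, Prop. 2.2, "only if"). [cite: BhargavaTaniguchiThorne2023, Proposition 2.2 (maximal ⇒ f ∈ U_p for all p)] -/
theorem memU_of_isMaximal (hf : IsMaximal f) {p : ℕ} (hp : 1 < p) : f.MemU p := by
  by_contra h
  exact not_isMaximal_of_not_memU hp h hf

/-- A maximal `R(f)` has primitive `f` (content `1`: no `p > 1` divides all coefficients). [folklore] -/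
theorem not_isMultiple_of_isMaximal (hf : IsMaximal f) {p : ℕ} (hp : 1 < p) : ¬ f.IsMultiple p :=
  (memU_of_isMaximal hf hp).1

end RingOfForm

end Literature.NumberTheory.CubicFields
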